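import Literature.AlgebraicGeometry.Resolution.HasseSchmidtDualExistence
import Literature.AlgebraicGeometry.Resolution.DerivativeIdealsSupport
import Literature.AlgebraicGeometry.Resolution.SmoothStalksRegular
import Literature.AlgebraicGeometry.Resolution.RegularSystemOfParameters
import HarnessLib

/-!
# Dual Hasse–Schmidt derivations at the points of a scheme smooth over a perfect field (scheme-level form)

Topic: `Literature/AlgebraicGeometry/Resolution`. Scheme-level packaging of `HasseSchmidtDualExistence.lean`
(`exists_hasseSchmidtDerivation_dual`: local-algebra form) in the style of `DerivativeIdealsSupport.lean`
(`hasLocalCoordinates_overHom`: FIRST-order dual derivations at every point of a smooth scheme over a perfect field):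
for `X` smooth over a PERFECT field `k`, ANY point `x ∈ X` and any minimal system of generators `u` of `𝔪_{X,x}`,

* `exists_hasseSchmidtDerivation_dual_stalk` — for every index `i` there is a Hasse–Schmidt derivation `D` of
  `𝒪_{X,x}` over `k` (`HasseSchmidtTransverseOrder.HasseSchmidtDerivation`) with `D_1 u_i = 1`, `D_1 u_l = 0` (`l ≠ i`),
  `D_b u_l = 0` (`b ≥ 2`) — EGA IV₄ 16.11.2 along the local coordinates `u`;
* `exists_rsop_hasseSchmidtDerivation_dual_stalk` — a regular system of parameters of the (regular) local ring
  `𝒪_{X,x}` TOGETHER with a full dual family `D_1, …, D_d`, `d = emb dim`.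

The `k`-structure of the stalk is `stalkAlgebra (overHom k X) x` (`DerivativeIdealSheaf.lean`); the inputs are
`essFiniteType_stalk_overHom`, `formallySmooth_stalk_overHom` (`DerivativeIdealsSupport.lean`),
`formallySmooth_residueField_of_perfectField` (`SmoothCoordinates.lean`), `isRegularLocalRing_stalk_of_smooth_of_field`
(`SmoothStalksRegular.lean`) and `exists_regularSystemOfParameters`. Nothing new is proved; no definitions.

## Sources

* [EGAIV4] A. Grothendieck, J. Dieudonné, ÉGA IV₄, Publ. Math. IHÉS 32 (1967), Thm. 16.11.2.
* [Matsumura1987] H. Matsumura, *Commutative Ring Theory* (1986), Thm. 30.6 (ii), §27.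
-/

noncomputable section

namespace Literature.AlgebraicGeometry.Resolution

open _root_.AlgebraicGeometry IsLocalRing

universe u w

variable (k : Type u) [Field k] [PerfectField k] (X : Scheme.{u}) [X.Over (Spec (.of k))]
  [Smooth (X ↘ Spec (.of k))]

/-- **Dual Hasse–Schmidt derivations at a point of a smooth scheme over a perfect field**: for ANY point `x` of
`X` smooth over the perfect field `k`, every minimal generating family `u : ι → 𝔪_{X,x}` (`|ι| = emb dim`) and every
`i`, there is a Hasse–Schmidt derivation `D` of `𝒪_{X,x}` over `k` with `D_1 u_i = 1`, `D_1 u_l = 0` for `l ≠ i` and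
`D_b u_l = 0` for `b ≥ 2` (each `D_b` a differential operator of order `≤ b`, `HasseSchmidtDerivation.isDiffOpLE_op`).
[cite: EGAIV4, Thm. 16.11.2] -/
theorem exists_hasseSchmidtDerivation_dual_stalk (x : X) {ι : Type w} [Fintype ι] [DecidableEq ι]
    (u : ι → X.presheaf.stalk x)
    (hu : Ideal.span (Set.range u) = maximalIdeal (X.presheaf.stalk x))
    (hcard : Fintype.card ι = (maximalIdeal (X.presheaf.stalk x)).spanFinrank) (i : ι) :
    letI := stalkAlgebra (overHom k X) x
    ∃ D : HasseSchmidtDerivation k (X.presheaf.stalk x),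
      ∀ b l, D.op b (u l) = if b = 0 then u l else if b = 1 ∧ l = i then 1 else 0 := by
  letI := stalkAlgebra (overHom k X) x
  haveI : Algebra.EssFiniteType k (X.presheaf.stalk x) := essFiniteType_stalk_overHom k X x
  haveI : Algebra.FormallySmooth k (X.presheaf.stalk x) := formallySmooth_stalk_overHom k X x
  haveI : Algebra.FormallySmooth k (ResidueField (X.presheaf.stalk x)) :=
    formallySmooth_residueField_of_perfectField (k := k) (A := X.presheaf.stalk x)
  exact exists_hasseSchmidtDerivation_dual (k := k) u hu hcard i

/-- **A regular system of parameters with dual Hasse–Schmidt derivations exists at every point of a smooth scheme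
over a perfect field**: `𝒪_{X,x}` is a regular local ring (Stacks 056S), so it has a regular system of parameters
`u_1, …, u_d`, `d = emb dim 𝒪_{X,x}`, and by `exists_hasseSchmidtDerivation_dual_stalk` a family `D_1, …, D_d` of
Hasse–Schmidt derivations over `k` dual to it. [cite: EGAIV4, Thm. 16.11.2]
[cite: Matsumura1987, Thm. 30.6 (ii)] -/
theorem exists_rsop_hasseSchmidtDerivation_dual_stalk (x : X) :
    letI := stalkAlgebra (overHom k X) x
    ∃ (u : Fin (maximalIdeal (X.presheaf.stalk x)).spanFinrank → X.presheaf.stalk x)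
      (D : Fin (maximalIdeal (X.presheaf.stalk x)).spanFinrank →
        HasseSchmidtDerivation k (X.presheaf.stalk x)),
      Ideal.span (Set.range u) = maximalIdeal (X.presheaf.stalk x) ∧
        ∀ i b l, (D i).op b (u l) = if b = 0 then u l else if b = 1 ∧ l = i then 1 else 0 := by
  letI := stalkAlgebra (overHom k X) x
  haveI : IsRegularLocalRing (X.presheaf.stalk x) :=
    isRegularLocalRing_stalk_of_smooth_of_field (X ↘ Spec (.of k)) x
  obtain ⟨u, hu⟩ := exists_regularSystemOfParameters (R := X.presheaf.stalk x)
  have h := fun i => exists_hasseSchmidtDerivation_dual_stalk k X x u hu (Fintype.card_fin _) i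
  choose D hD using h
  exact ⟨u, D, hu, hD⟩

end Literature.AlgebraicGeometry.Resolution

end
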